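import Summits.ValiantsHypothesis.ValiantsHypothesis.Theorems.KPlusLogSqLawTropicalBSeparable

/-!
# Route `KPlusLogSqLaw`, crux `TropicalB` — SEPARABLE designs: the dominant chain is a chain of `m`-SUBSETS of the classes,
# `n + 1 ≤ C(K, m)` (tropical twin of the rank-one pencil ceiling)

HONEST FRAMING.  Helper toward the registered stubs of `Cruxes/TropicalB/Lines/birth.lean` (crux
`Summit.ValiantsHypothesis.ValiantsHypothesis.Theses.KPlusLogSqLaw.TropicalB`, item `stmt-ValiantsHypothesis-19771`); hand
leafhand-val-kpluslogsqlaw-1 g5.  A SHARPENING of the tree's located no-go `…TropicalBSeparable` (val-sym-trop-p3: separable full-support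
designs have injective class maps, hence NO dominant term for `K < m` and the fat-end bound `2^{2K}` for `m ≤ K`): the exact count.
Nothing here bounds `TropicalB` for general designs; nothing bears on `KPlusLogSqLaw`, `MatrixDescartes` or `VP ≠ VNP`.

If every valuation is separable (`v a b l = r a l + c b l`) and every entry carries every class, the class map of a dominant term is
injective (`injective_classes_of_dominant_separable`, tree), so the term's slope is the sum of `d` over the `m`-SUBSET of classes it
uses (`slope_eq_sum_image`); slopes strictly increase along a dominant sign-alternating chain (`TropicalCensus.slope_lt_of_dominant`,
tree), so the subsets are pairwise distinct:

* `succ_le_choose_of_separable` — a dominant sign-alternating chain `p₀, …, pₙ` of a separable full-support design of format `(m, K)`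
  has `n + 1 ≤ C(K, m)`; `le_choose_sub_one_of_separable` — `n ≤ C(K, m) − 1` (tree: `2^{2K}` for `m ≤ K`; slope counting
  `C(m+K−1, m) − 1` for general designs).

This is the tropical twin of the real-side rank-one ceiling `…TowerGraftRankOnePencils.card_posRoots_le_choose_sub_one_of_rank_le_one`
(`Z₊ ≤ C(K, m) − 1` for pencils with rank-one letters): a separable full-support class is the design of a rank-one letter
`t^{d_l} · (x_a y_b)` (valuation `val x_a + val y_b`, sign `sgn x_a · sgn y_b`). [folklore]
-/

set_option linter.dupNamespace false
set_option autoImplicit false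

namespace Summit.ValiantsHypothesis.ValiantsHypothesis.Theorems.KPlusLogSqLaw.SeparableSubsets

open Summit.ValiantsHypothesis.ValiantsHypothesis.Theorems.MatrixDescartes.Negative
open Summit.ValiantsHypothesis.ValiantsHypothesis.Theorems.LacunarySymmetroidMatrixDescartes.TropicalCensus
open Summit.ValiantsHypothesis.ValiantsHypothesis.Theorems.KPlusLogSqLaw (injective_classes_of_dominant_separable)
open scoped BigOperators
open Finset

variable {m K : ℕ}

/-- The slope of a term with INJECTIVE class map is the sum of `d` over the set of classes it uses. [folklore] -/
theorem slope_eq_sum_image (d : Fin K → ℕ) (q : Equiv.Perm (Fin m) × (Fin m → Fin K)) (hq : Function.Injective q.2) :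
    LacunarySymmetroidMatrixDescartes.TropicalCensus.slope d q = ∑ l ∈ (Finset.univ : Finset (Fin m)).image q.2, (d l : ℤ) := by
  unfold LacunarySymmetroidMatrixDescartes.TropicalCensus.slope
  rw [Finset.sum_image fun i _ j _ h => hq h]

/-- The set of classes of a term with injective class map is an `m`-subset of the classes. [folklore] -/
theorem image_mem_powersetCard (q : Equiv.Perm (Fin m) × (Fin m → Fin K)) (hq : Function.Injective q.2) :
    (Finset.univ : Finset (Fin m)).image q.2 ∈ (Finset.univ : Finset (Fin K)).powersetCard m := by
  rw [Finset.mem_powersetCard]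
  refine ⟨Finset.subset_univ _, ?_⟩
  rw [Finset.card_image_of_injective _ hq, Finset.card_univ, Fintype.card_fin]

/-- **SEPARABLE DESIGNS: `n + 1 ≤ C(K, m)`.**  A dominant sign-alternating chain of a separable full-support design of format
`(m, K)` visits pairwise distinct `m`-subsets of the `K` classes. [folklore] -/
theorem succ_le_choose_of_separable (d : Fin K → ℕ) (v ε : Fin m → Fin m → Fin K → ℤ)
    (r : Fin m → Fin K → ℤ) (c : Fin m → Fin K → ℤ) (hv : ∀ a b l, v a b l = r a l + c b l)
    (hε : ∀ a b l, ε a b l ≠ 0)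
    {n : ℕ} (θ : Fin (n + 1) → ℤ) (p : Fin (n + 1) → Equiv.Perm (Fin m) × (Fin m → Fin K))
    (hθ : StrictMono θ) (hdom : ∀ k, IsDominant d v ε (θ k) (p k))
    (halt : ∀ k : Fin n, termSign ε (p k.castSucc) * termSign ε (p k.succ) < 0) :
    n + 1 ≤ K.choose m := by
  -- consecutive terms are distinct (their signs multiply to a negative number)
  have hne : ∀ k : Fin n, p k.castSucc ≠ p k.succ := by
    intro k h
    have := halt k
    rw [h] at this
    exact absurd this (not_lt.mpr (mul_self_nonneg _))
  -- slopes strictly increase along the chain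
  have hsm : StrictMono fun k => LacunarySymmetroidMatrixDescartes.TropicalCensus.slope d (p k) := by
    rw [Fin.strictMono_iff_lt_succ]
    intro k
    exact slope_lt_of_dominant d v ε (hθ (Fin.castSucc_lt_succ (i := k))) (hne k) (hdom _) (hdom _)
  -- every term has an injective class map
  have hinjq : ∀ k, Function.Injective (p k).2 := fun k =>
    injective_classes_of_dominant_separable d v ε r c hv hε (θ k) (p k).1 (p k).2 (hdom k)
  -- so the class sets are pairwise distinct `m`-subsets
  have hinj : Function.Injective fun k => (Finset.univ : Finset (Fin m)).image (p k).2 := by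
    intro k k' h
    apply hsm.injective
    simp only
    rw [slope_eq_sum_image d (p k) (hinjq k), slope_eq_sum_image d (p k') (hinjq k')]
    exact congrArg (fun s : Finset (Fin K) => ∑ l ∈ s, (d l : ℤ)) h
  have hcard := Finset.card_le_card_of_injOn (s := (Finset.univ : Finset (Fin (n + 1))))
    (t := (Finset.univ : Finset (Fin K)).powersetCard m)
    (fun k => (Finset.univ : Finset (Fin m)).image (p k).2)
    (fun k _ => image_mem_powersetCard (p k) (hinjq k)) (fun k _ k' _ h => hinj h)
  rw [Finset.card_univ, Fintype.card_fin, Finset.card_powersetCard, Finset.card_univ, Fintype.card_fin] at hcard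
  exact hcard

/-- **SEPARABLE DESIGNS: at most `C(K, m) − 1` breakpoints** (the format's slope-counting ceiling is `C(m+K−1, m) − 1`; for `K < m`
this is the tree's «no dominant term», for `K = m` it says a dominant term is alone, for `m = 2` it reads `C(K,2) − 1` — the twin of the
isotropic `2 × 2` row `…TowerGraftIsotropicLetters.card_posRoots_le_of_isotropic`). [folklore] -/
theorem le_choose_sub_one_of_separable (d : Fin K → ℕ) (v ε : Fin m → Fin m → Fin K → ℤ)
    (r : Fin m → Fin K → ℤ) (c : Fin m → Fin K → ℤ) (hv : ∀ a b l, v a b l = r a l + c b l)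
    (hε : ∀ a b l, ε a b l ≠ 0)
    {n : ℕ} (θ : Fin (n + 1) → ℤ) (p : Fin (n + 1) → Equiv.Perm (Fin m) × (Fin m → Fin K))
    (hθ : StrictMono θ) (hdom : ∀ k, IsDominant d v ε (θ k) (p k))
    (halt : ∀ k : Fin n, termSign ε (p k.castSucc) * termSign ε (p k.succ) < 0) :
    n ≤ K.choose m - 1 := by
  have h := succ_le_choose_of_separable d v ε r c hv hε θ p hθ hdom halt
  omega

/-- Separable full-support designs of format `(m, m + 1)`: at most `m` breakpoints. [folklore] -/
theorem le_of_separable_succ (d : Fin (m + 1) → ℕ) (v ε : Fin m → Fin m → Fin (m + 1) → ℤ)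
    (r : Fin m → Fin (m + 1) → ℤ) (c : Fin m → Fin (m + 1) → ℤ) (hv : ∀ a b l, v a b l = r a l + c b l)
    (hε : ∀ a b l, ε a b l ≠ 0)
    {n : ℕ} (θ : Fin (n + 1) → ℤ) (p : Fin (n + 1) → Equiv.Perm (Fin m) × (Fin m → Fin (m + 1)))
    (hθ : StrictMono θ) (hdom : ∀ k, IsDominant d v ε (θ k) (p k))
    (halt : ∀ k : Fin n, termSign ε (p k.castSucc) * termSign ε (p k.succ) < 0) :
    n ≤ m := by
  have h := succ_le_choose_of_separable d v ε r c hv hε θ p hθ hdom halt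
  rw [Nat.choose_succ_self_right] at h
  omega

/-- **SEPARABLE DESIGNS OBEY THE `m`-FREE EXPONENTIAL LAW `n + 1 ≤ 2^K`** (rev 2): since `C(K, m) ≤ 2^K`
(`Nat.choose_le_two_pow`), a dominant sign-alternating chain of a separable full-support design of format `(m, K)` has at most `2^K`
terms, uniformly in the size `m` — no `log² m` term at all (the tree's `separable_kPlusLogSq` gave `2^{2(K + log₂² m)}`). [folklore] -/
theorem succ_le_two_pow_of_separable (d : Fin K → ℕ) (v ε : Fin m → Fin m → Fin K → ℤ)
    (r : Fin m → Fin K → ℤ) (c : Fin m → Fin K → ℤ) (hv : ∀ a b l, v a b l = r a l + c b l)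
    (hε : ∀ a b l, ε a b l ≠ 0)
    {n : ℕ} (θ : Fin (n + 1) → ℤ) (p : Fin (n + 1) → Equiv.Perm (Fin m) × (Fin m → Fin K))
    (hθ : StrictMono θ) (hdom : ∀ k, IsDominant d v ε (θ k) (p k))
    (halt : ∀ k : Fin n, termSign ε (p k.castSucc) * termSign ε (p k.succ) < 0) :
    n + 1 ≤ 2 ^ K :=
  (succ_le_choose_of_separable d v ε r c hv hε θ p hθ hdom halt).trans (Nat.choose_le_two_pow K m)

/-- The same in the crux's row currency: separable full-support designs satisfy `TropicalB`'s inequality with `C = 1` and WITHOUT the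
`log₂² m` term, `n ≤ 2^K − 1 ≤ 2^(1·(K + log₂² m))`. [folklore] -/
theorem le_two_pow_of_separable (d : Fin K → ℕ) (v ε : Fin m → Fin m → Fin K → ℤ)
    (r : Fin m → Fin K → ℤ) (c : Fin m → Fin K → ℤ) (hv : ∀ a b l, v a b l = r a l + c b l)
    (hε : ∀ a b l, ε a b l ≠ 0)
    {n : ℕ} (θ : Fin (n + 1) → ℤ) (p : Fin (n + 1) → Equiv.Perm (Fin m) × (Fin m → Fin K))
    (hθ : StrictMono θ) (hdom : ∀ k, IsDominant d v ε (θ k) (p k))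
    (halt : ∀ k : Fin n, termSign ε (p k.castSucc) * termSign ε (p k.succ) < 0) :
    n ≤ 2 ^ (1 * (K + Nat.log 2 m ^ 2)) := by
  have h := succ_le_two_pow_of_separable d v ε r c hv hε θ p hθ hdom halt
  have h2 : 2 ^ K ≤ 2 ^ (1 * (K + Nat.log 2 m ^ 2)) := Nat.pow_le_pow_right (by norm_num) (by omega)
  omega

end Summit.ValiantsHypothesis.ValiantsHypothesis.Theorems.KPlusLogSqLaw.SeparableSubsets
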